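import Mathlib
import Summits.ResolutionOfSingularities.ResolutionOfSingularities.Theorems.WeightedInvariantLocalWeightedDropWildMonicFlagDropAxisSplit
import Summits.ResolutionOfSingularities.ResolutionOfSingularities.Theorems.WeightedInvariantLocalWeightedDropWildMonicFlagExit
import Summits.ResolutionOfSingularities.ResolutionOfSingularities.Theorems.WeightedInvariantLocalWeightedDropWildMonicFlagSwapReading
import Summits.ResolutionOfSingularities.ResolutionOfSingularities.Theorems.WeightedInvariantLocalWeightedDropWildMonicFlagSettingDict
import Summits.ResolutionOfSingularities.ResolutionOfSingularities.Theorems.WeightedInvariantLocalWeightedDropWildMonicShiftOrderCases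

/-!
# `WeightedInvariant.LocalWeightedDrop`, line `hasse-ridge-face-selection`, S3ρ: the CANONICAL `n = 0` FLAG PAIR OF AN AXIS STEP —
# one package (Per17 Prop 9.1.1 (`n_F = 0`), Prop 7.4.5, Lemma 9.1.2) serving the child-flag types N0-FIRST and N0-SECOND

Crux item stmt-ResolutionOfSingularities-8899 `LocalWeightedDrop` (route `ResolutionOfSingularities/WeightedInvariant`), engine of the door
`HypersurfaceCentreConstruction` stmt-ResolutionOfSingularities-19897.  [OURS · L1 W4.3, chain w43, res-type-083 (S3ρ first seat, (C9) lead): the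
CUT for the hands of `DropAxisN0First` (Uk-ρD1) and `DropAxisN0Second` (Uk-ρD4) of `…WildMonicFlagDropAxisSplit`.  MAP: S. Perlega,
arXiv:2011.14443 Prop 9.1.1 (p0103: induced flag, `n_F = 0`: «`n_{F′} = 0`, `d_{F′} ≤ d_F`, and `d_{F′} = d_F ∧ s_F < ∞ ⇒ s_{F′} < s_F`»),
Prop 7.4.5 (p0093: the clean hypersurface makes the transversal flag valid, `d`-maximal among valid comparable flags, and — secondary
`s`-clean — `s`-maximal over the hypersurfaces), Lemma 9.1.2 (p0104: when `d` is kept, the flag along the new exceptional curve never wins;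
its heart «`ord_(x) minit(J_{2,x₁}(a′)) < r_x + d`» is item (v) below); every object OURS; not a statement of any manuscript.]

WHY A PACKAGE.  The two child-flag types with `n = 0` at an axis point are NOT served by dominating «some» parent flag: when the residual order
DROPS (`d′ < d`) the flag along `D_new` can beat the induced flag on `s` (example `I₂ = (y² − x³)`-type: child `in(I₂′) = x`, second reading
`s = 2·1! > 1!`), and Per17 then dominates by the PARENT flag through `d` alone; when `d` is KEPT, Lemma 9.1.2's face point makes the second
reading minimal.  Both types therefore consume the SAME canonical pair `(F, F′) = ((g₀, 0), (g₀′, 0))` — the simultaneously clean parent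
hypersurface and its induced child hypersurface — with the seven properties below; `AxisPackageN0 d p k` states their existence for every
charged axis step.  Hands: the PACKAGE is Uk-ρD1's heart (stub-7: (C1)–(C4) transports); `DropAxisN0Second ⇐ AxisPackageN0` is Uk-ρD4
(`…FlagSwapReading`); `DropAxisN0First ⇐ AxisPackageN0` (`h = 0` directly; `h ≠ 0`, i.e. `V(x₂)` not boundary, through the shear
`(x, y + x·h(x))` whose axis successor is the child sheared by `h`) closes Uk-ρD1.
-/

set_option linter.dupNamespace false -- mandated namespace of this single-conjunct summit

noncomputable section

namespace Summit.ResolutionOfSingularities.ResolutionOfSingularities.Theorems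

open Literature.AlgebraicGeometry.Resolution
open Literature.AlgebraicGeometry.Resolution.HauserPerlega2024 (Triple)

namespace WildMonic

open MvPowerSeries MonicDescent
open PurePowerFlag (swap swapE orient orientE IsN0 IsTangent succE)

variable {k : Type} [Field k] {d : ℕ}

/-- THE CANONICAL `n = 0` FLAG PAIR OF A CHARGED AXIS STEP `(A, E; T, φ')` (child `C = shift d T φ'`, `E′ = succE 0 E`): hypersurface
re-centrings `g₀` (parent) and `g₀′` (child), flags `F = (false, g₀, 0)`, `F′ = (false, g₀′, 0)`, Newton sets `N(g) = newtonSet (flagTuple d A g 0)`,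
`N′(g) = newtonSet (flagTuple d C g 0)`, such that
 (i)  `F` is valid (`IsMMax d A E g₀ 0`) and (ii) `F′` is valid;
 (iii) `F′` is `d`-MAXIMAL among the valid `n = 0`, `h = 0` child flags [Per17 Prop 7.4.5 (2) at the child];
 (iv) `d_{F′} ≤ d_F` [Prop 9.1.1];
 (v)  if `d_{F′} = d_F` then EVERY valid child hypersurface `g` with `d(g) = d_{F′}` has a FACE POINT `P₀ < d` in its reduced set
      [Lemma 9.1.2's heart: `ρ`-maximality of the clean hypersurface + the corner `(0, d)` of the weak transform];
 (vi) if `d_{F′} = d_F` then `s_{F′} < s_F` or `s_F = ⊤` [Prop 9.1.1, third bullet; stub-7's `sValue_excNext_image_psi_lt`];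
 (vii) `F′` is `s`-MAXIMAL among the valid child hypersurfaces with `d = d_{F′}` [Prop 7.4.5 (3): secondary `s`-cleanness, (C4)]. -/
def AxisPackageN0 (d p : ℕ) (k : Type) [Field k] : Prop :=
  ∀ (A : Fin d → MvPowerSeries (Fin 2) k) (E : Finset (Fin 2)) (T : Fin d → MvPowerSeries (Fin 2) k) (φ' : MvPowerSeries (Fin 2) k),
    IsAxisStep d p A T φ' →
    ∃ (g₀ g₀' : MvPowerSeries (Fin 2) k), constantCoeff g₀ = 0 ∧ constantCoeff g₀' = 0 ∧
      IsMMax d A E g₀ 0 ∧ IsMMax d (shift d T φ') (succE (0 : k) E) g₀' 0 ∧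
      (∀ g : MvPowerSeries (Fin 2) k, constantCoeff g = 0 → IsMMax d (shift d T φ') (succE (0 : k) E) g 0 →
        dRes (succE (0 : k) E) (newtonSet (flagTuple d (shift d T φ') g 0)) ≤
          dRes (succE (0 : k) E) (newtonSet (flagTuple d (shift d T φ') g₀' 0))) ∧
      dRes (succE (0 : k) E) (newtonSet (flagTuple d (shift d T φ') g₀' 0)) ≤ dRes E (newtonSet (flagTuple d A g₀ 0)) ∧
      (dRes (succE (0 : k) E) (newtonSet (flagTuple d (shift d T φ') g₀' 0)) = dRes E (newtonSet (flagTuple d A g₀ 0)) →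
        ∀ g : MvPowerSeries (Fin 2) k, constantCoeff g = 0 → IsMMax d (shift d T φ') (succE (0 : k) E) g 0 →
          dRes (succE (0 : k) E) (newtonSet (flagTuple d (shift d T φ') g 0)) =
            dRes (succE (0 : k) E) (newtonSet (flagTuple d (shift d T φ') g₀' 0)) →
          ∃ P ∈ reduce (excExp (succE (0 : k) E) (newtonSet (flagTuple d (shift d T φ') g 0)))
              (newtonSet (flagTuple d (shift d T φ') g 0)),
            P 0 < dRes (succE (0 : k) E) (newtonSet (flagTuple d (shift d T φ') g 0)) ∧
            P 0 + P 1 = dRes (succE (0 : k) E) (newtonSet (flagTuple d (shift d T φ') g 0))) ∧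
      (dRes (succE (0 : k) E) (newtonSet (flagTuple d (shift d T φ') g₀' 0)) = dRes E (newtonSet (flagTuple d A g₀ 0)) →
        sValue d.factorial (succE (0 : k) E) (newtonSet (flagTuple d (shift d T φ') g₀' 0)) <
            sValue d.factorial E (newtonSet (flagTuple d A g₀ 0)) ∨
          sValue d.factorial E (newtonSet (flagTuple d A g₀ 0)) = ⊤) ∧
      (∀ g : MvPowerSeries (Fin 2) k, constantCoeff g = 0 → IsMMax d (shift d T φ') (succE (0 : k) E) g 0 →
        dRes (succE (0 : k) E) (newtonSet (flagTuple d (shift d T φ') g 0)) =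
          dRes (succE (0 : k) E) (newtonSet (flagTuple d (shift d T φ') g₀' 0)) →
        sValue d.factorial (succE (0 : k) E) (newtonSet (flagTuple d (shift d T φ') g 0)) ≤
          sValue d.factorial (succE (0 : k) E) (newtonSet (flagTuple d (shift d T φ') g₀' 0)))

/-- The triple of an `n = 0`, `h = 0` flag in terms of the package's numbers (unfolding). -/
theorem flagTriple_zero_eq (A : Fin d → MvPowerSeries (Fin 2) k) (E : Finset (Fin 2)) (g : MvPowerSeries (Fin 2) k) :
    flagTriple d A E g 0 = toLex (dRes E (newtonSet (flagTuple d A g 0)), toLex (0, sValue d.factorial E (newtonSet (flagTuple d A g 0)))) :=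
  flagTriple_of_isN0 (Or.inr rfl)

/-! ### Service lemmas for the hands: the flag tuples of a position are weak positions, and are non-zero off `Exit₃` -/

/-- A series without constant term has `(1,1)`-weighted order `≥ 1`. -/
theorem one_le_weightedOrder_of_constantCoeff {g : MvPowerSeries (Fin 2) k} (hg : constantCoeff g = 0) :
    (1 : ℕ∞) ≤ g.weightedOrder (fun _ : Fin 2 => 1) := by
  refine MvPowerSeries.le_weightedOrder _ fun e he => ?_
  have hw : Finsupp.weight (fun _ : Fin 2 => 1) e < 1 := by exact_mod_cast he
  rw [weight_fin_two] at hw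
  have he0 : e = 0 :=
    Literature.RingTheory.TwoVariableSeries.finsupp_fin2_ext (by simp; omega) (by simp; omega)
  rw [he0, coeff_zero_eq_constantCoeff, hg]

/-- THE FLAG TUPLES OF A POSITION ARE WEAK POSITIONS: after any re-centring `y ↦ y + g`, `g(0) = 0`, every point of the scaled Newton set
still has total degree `≥ d!` (Perlega Lemma 5.1.1: `m(shift) ≥ min(m, d!·ord g)`).  Supplies the hypothesis `hL` of the point-set transports
and of `flagTriple_swapT_zero_le`. -/
theorem factorial_le_of_mem_newtonSet_shift {A : Fin d → MvPowerSeries (Fin 2) k} (hA : IsPos d A) {g : MvPowerSeries (Fin 2) k}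
    (hg : constantCoeff g = 0) {P : Fin 2 →₀ ℕ} (hP : P ∈ newtonSet (shift d A g)) : d.factorial ≤ P 0 + P 1 := by
  rcases Nat.eq_zero_or_pos d with hd | hd
  · subst hd
    obtain ⟨j, -, -, -⟩ := hP
    exact j.elim0
  set w : Fin 2 → ℕ := fun _ => 1 with hw
  have hwt : ∀ Q : Fin 2 →₀ ℕ, Finsupp.weight w Q = Q 0 + Q 1 := fun Q => by rw [weight_fin_two]; simp [hw]
  have hA' : ((d.factorial : ℕ) : ℕ∞) ≤ wMin w A := by
    rw [le_wMin_iff_newtonSet]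
    intro Q hQ
    rw [hwt]
    exact_mod_cast (factorial_lt_of_mem_newtonSet hA hQ).le
  have hshift : ((d.factorial : ℕ) : ℕ∞) ≤ wMin w (shift d A g) := by
    by_cases hG : wMin w A ≤ (d.factorial : ℕ∞) * g.weightedOrder w
    · exact hA'.trans (wMin_le_wMin_shift w A g hG)
    · rw [not_le] at hG
      rw [wMin_shift_eq_of_gt w A g hd hG]
      calc ((d.factorial : ℕ) : ℕ∞) = (d.factorial : ℕ∞) * 1 := (mul_one _).symm
        _ ≤ (d.factorial : ℕ∞) * g.weightedOrder w := by gcongr; exact one_le_weightedOrder_of_constantCoeff hg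
  have h := (le_wMin_iff_newtonSet w (shift d A g)).mp hshift P hP
  rw [hwt] at h
  exact_mod_cast h

/-- OFF `Exit₃`, NO RE-CENTRING ANNIHILATES A POSITION: the scaled Newton set of `shift d A g` is nonempty (the zero tuple would be the fourth
exit, `exit₃_shift_iff`).  Supplies the hypothesis `hne` of the point-set lemmas. -/
theorem newtonSet_shift_nonempty_of_not_exit₃ {p : ℕ} {A : Fin d → MvPowerSeries (Fin 2) k} (hex : ¬ Exit₃ p d A)
    {g : MvPowerSeries (Fin 2) k} (hg : constantCoeff g = 0) : (newtonSet (shift d A g)).Nonempty := by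
  by_contra hne
  have h0 : ∀ j, shift d A g j = 0 := (newtonSet_eq_empty_iff _).mp (Set.not_nonempty_iff_eq_empty.mp hne)
  refine hex ((exit₃_shift_iff hg).mp (exit₃_of_eq_zero (fun j => ?_) h0))
  rw [h0 j, order_zero]
  exact ENat.coe_lt_top _

/-- … in the flag form used by `IsFlagTriple` (`h = 0`). -/
theorem newtonSet_flagTuple_zero_nonempty_of_not_exit₃ {p : ℕ} {A : Fin d → MvPowerSeries (Fin 2) k} (hex : ¬ Exit₃ p d A)
    {g : MvPowerSeries (Fin 2) k} (hg : constantCoeff g = 0) : (newtonSet (flagTuple d A g 0)).Nonempty := by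
  rw [flagTuple_zero_shear]
  exact newtonSet_shift_nonempty_of_not_exit₃ hex hg

/-- … and the weak positivity in the flag form (`h = 0`). -/
theorem factorial_le_of_mem_newtonSet_flagTuple_zero {A : Fin d → MvPowerSeries (Fin 2) k} (hA : IsPos d A) {g : MvPowerSeries (Fin 2) k}
    (hg : constantCoeff g = 0) {P : Fin 2 →₀ ℕ} (hP : P ∈ newtonSet (flagTuple d A g 0)) : d.factorial ≤ P 0 + P 1 := by
  rw [flagTuple_zero_shear] at hP
  exact factorial_le_of_mem_newtonSet_shift hA hg hP

end WildMonic

end Summit.ResolutionOfSingularities.ResolutionOfSingularities.Theorems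

end
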